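import Summits.AtomisticToContinuum.Crystallization.Theorems.OverbindingBudgetAffineRunCutLevels
import Summits.AtomisticToContinuum.Crystallization.Theorems.OverbindingBudgetAffineRunCutRebase

/-!
# `OverbindingBudget` / crux `RobustDefectLimitWindows` (stmt-AtomisticToContinuum-31280) — «RunCut»: (T3) `estab_of_read` + the record forms of (T2-metric)+(β)

Support file (lens-4 g88, part 18; critic rows 1573 (T3) / 1574 (B); memo `g87/memo/SW-CHI.md` §10.8).

* §1 (T3) ★★ `estab_of_read` — in the re-based layer-rigidity datum at a base `i` (clauses as hypotheses over an abstract base frame `B`,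
  `399/400·ν·‖z‖ ≤ ‖B z‖`), EVERY site `m` of the reading ball `dist (y m) (y i) ≤ (106/25)·ν` IS ESTABLISHED: the position clause reads a layer label
  `ref ℓ + x` (`|ℓ| ≤ 5`, `x` in-layer); the label lies in the box of the establishment clause (`‖mv label‖ ≤ (106/25 + 0.3902)/(399/400) ≤ 4.642 ≤ 24/5`
  and the tree's `…CompressedCutReadingA.level_box`: `|u_c| ≤ 18 − |ℓ|` for the centred in-layer part `u`); the established site of that label
  sits within `dR ν 31 ≤ T` of the same model point, so site uniqueness identifies it with `m`.  This is the «m established in both data» hypothesis of the atlas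
  gluing (2b)/(2c), now automatic on the overlap of two reading balls.
* §2 RECORD FORMS — the hypotheses of `…RunCutLevels.levels_fcc_of_not_hNear` and of `estab_of_read` discharged from ONE chart datum on `B(y c, ρ·ν_c)`
  (`…RunCutRebase.ball_restrict`, `base_lower`/`base_upper`, `lower_flip`/`upper_flip`) in the record frame `(ν_i • A i) ∘ₗ flipIso s`:
  ★★ `levels_fcc_of_rebase` (five cubic levels at a base with `¬HNear 2`), ★ `estab_of_read_rebase`.
-/

namespace Summit.AtomisticToContinuum.Crystallization.Theorems.OverbindingBudgetAffineRunCutRead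

open Literature.Geometry.DiscreteGeometry (nearestDist nearestDist_nonneg fccTwoShellPattern hcpTwoShellPattern)
open Summit.AtomisticToContinuum.Crystallization.Theorems.OverbindingBudgetAffineCompressedCutKernel (T3 tsub tadd tsq thsum fccL fccNegL hcpL hcpAltL)
open Summit.AtomisticToContinuum.Crystallization.Theorems.OverbindingBudgetAffineCompressedCutCharts (mv)
open Summit.AtomisticToContinuum.Crystallization.Theorems.OverbindingBudgetAffineCompressedCutReadingA (level_box)
open Summit.AtomisticToContinuum.Crystallization.Theorems.OverbindingBudgetAffineCompressedCutEstablish (Estab base_lower nearestDist_pos_of_frame)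
open Summit.AtomisticToContinuum.Crystallization.Theorems.OverbindingBudgetAffineCompressedCutEstablishTwo (IsSign flipIso lower_flip)
open Summit.AtomisticToContinuum.Crystallization.Theorems.OverbindingBudgetAffineCompressedCutStepA (upper_flip)
open Summit.AtomisticToContinuum.Crystallization.Theorems.OverbindingBudgetAffineCompressedCutSeed (InLayer)
open Summit.AtomisticToContinuum.Crystallization.Theorems.OverbindingBudgetAffineCompressedCutPatch (capv dL)
open Summit.AtomisticToContinuum.Crystallization.Theorems.OverbindingBudgetAffineCompressedCutBudget (tauR dR)
open Summit.AtomisticToContinuum.Crystallization.Theorems.OverbindingBudgetAffineCompressedCutFrame (base_upper)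
open Summit.AtomisticToContinuum.Crystallization.Theorems.OverbindingBudgetAffineCompressedCutRun (thsum_tadd tsub_tadd_self)
open Summit.AtomisticToContinuum.Crystallization.Theorems.OverbindingBudgetAffinePhaseCut (HNear)
open Summit.AtomisticToContinuum.Crystallization.Theorems.OverbindingBudgetAffineRunCutRebase (ball_restrict)
open Summit.AtomisticToContinuum.Crystallization.Theorems.OverbindingBudgetAffineRunCutLevelsA (dR_tauR_31)
open Summit.AtomisticToContinuum.Crystallization.Theorems.OverbindingBudgetAffineRunCutLevels (thsum_tsub tadd_tsub_centre levels_fcc_of_not_hNear)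

variable {N : ℕ}

local notation "E3" => EuclideanSpace ℝ (Fin 3)

/-! ## §0 One label identity (`level_box`, `coord_sq_le`, `cover_B` are the tree's: `…CompressedCutReadingA` / `…CompressedCutBudget`) -/

/-- `thsum (2ℓ,2ℓ,2ℓ) = 6ℓ`. [this file] -/
theorem thsum_centre (ℓ : ℤ) : thsum ((2 * ℓ, 2 * ℓ, 2 * ℓ) : T3) = 6 * ℓ := by
  unfold thsum
  ring

/-! ## The datum (hypotheses = the clauses of `…RunCutRebase.layer_rigidity_rebase_charts` at base `i`, frame `B`) -/

section Datum

variable {y : Fin N → E3} {i : Fin N} {A : Fin N → (E3 →ₗ[ℝ] E3)} {P : Fin N → Finset E3}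
  {B : E3 →ₗ[ℝ] E3} {ref : ℤ → T3} {Cz : ℤ → List T3}

variable (hν : 0 < nearestDist y i)
  (hBlo : ∀ z, 399 / 400 * nearestDist y i * ‖z‖ ≤ ‖B z‖)
  (hC1 : ∀ ℓ : ℤ, -5 ≤ ℓ → ℓ ≤ 5 → Cz ℓ ∈ [fccL, fccNegL, hcpL, hcpAltL] ∧ thsum (ref ℓ) = 6 * ℓ ∧ (ref ℓ).2.1 = (ref ℓ).1 ∧
      (3 : ℤ) ∣ ((ref ℓ).2.1 - (ref ℓ).2.2) ∧
      ∀ u : T3, InLayer (tsub (tadd (2 * ℓ, 2 * ℓ, 2 * ℓ) u) (ref ℓ)) → |u.1| ≤ 18 - |ℓ| → |u.2.1| ≤ 18 - |ℓ| → |u.2.2| ≤ 18 - |ℓ| →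
        ∃ k : Fin N, ∃ M : E3 →ₗᵢ[ℝ] E3,
          dist (y k) (y i) ≤ 12 * nearestDist y i ∧ 9026 / 10000 * nearestDist y i ≤ nearestDist y k ∧
          nearestDist y k ≤ 10347 / 10000 * nearestDist y i ∧
          Estab y A P B i k M (Cz ℓ) (tadd (2 * ℓ, 2 * ℓ, 2 * ℓ) u) (tauR (nearestDist y i) 31) (dR (nearestDist y i) 31))
  (hC4 : ∀ m, dist (y m) (y i) ≤ 106 / 25 * nearestDist y i → ∃ (ℓ : ℤ) (x : T3), -5 ≤ ℓ ∧ ℓ ≤ 5 ∧ InLayer x ∧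
      ‖y m - y i - B (mv (tadd (ref ℓ) x))‖ ≤
        dR (nearestDist y i) 31 + 1 / 10 ^ 4 * (10347 / 10000 * nearestDist y i) + tauR (nearestDist y i) 31 ∧
      9967 / 10000 * (9026 / 10000 * nearestDist y i) ≤ nearestDist y m)
  (hC5 : ∀ (m m' : Fin N) (r : T3), 9967 / 10000 * (9026 / 10000 * nearestDist y i) ≤ nearestDist y m' →
      ‖y m - y i - B (mv r)‖ ≤ dR (nearestDist y i) 31 + 1 / 10 ^ 4 * (10347 / 10000 * nearestDist y i) + tauR (nearestDist y i) 31 →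
      ‖y m' - y i - B (mv r)‖ ≤ dR (nearestDist y i) 31 + 1 / 10 ^ 4 * (10347 / 10000 * nearestDist y i) + tauR (nearestDist y i) 31 →
      m = m')

/-! ## §1 (T3) Every read site is established -/

include hν hBlo hC1 hC4 hC5

/-- ★★ **(T3) `estab_of_read`.**  Every site of the reading ball `B(y i, (106/25)·ν)` is ESTABLISHED in the datum: it carries a chart `M` registered to a copy of
the class `Cz ℓ` of its own level `ℓ ∈ [−5, 5]`, at a layer label `ref ℓ + x`, with the record scale window — so on the overlap of two reading balls every site is
established in BOTH data (the hypothesis of the atlas gluing). [this file] -/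
theorem estab_of_read {m : Fin N} (hdm : dist (y m) (y i) ≤ 106 / 25 * nearestDist y i) :
    ∃ (ℓ : ℤ) (x : T3) (M : E3 →ₗᵢ[ℝ] E3), -5 ≤ ℓ ∧ ℓ ≤ 5 ∧ InLayer x ∧
      9026 / 10000 * nearestDist y i ≤ nearestDist y m ∧ nearestDist y m ≤ 10347 / 10000 * nearestDist y i ∧
      Estab y A P B i m M (Cz ℓ) (tadd (ref ℓ) x) (tauR (nearestDist y i) 31) (dR (nearestDist y i) 31) := by
  obtain ⟨hD, hτ⟩ := dR_tauR_31 (nearestDist y i)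
  obtain ⟨ℓ, x, hℓ1, hℓ2, hxL, hpos, hνm⟩ := hC4 m hdm
  -- (1) the label has model norm `≤ 4.642`
  have hBa : ‖B (mv (tadd (ref ℓ) x))‖ ≤ 106 / 25 * nearestDist y i +
      (dR (nearestDist y i) 31 + 1 / 10 ^ 4 * (10347 / 10000 * nearestDist y i) + tauR (nearestDist y i) 31) := by
    have h := norm_sub_le (y m - y i) (y m - y i - B (mv (tadd (ref ℓ) x)))
    have e2 : (y m - y i) - (y m - y i - B (mv (tadd (ref ℓ) x))) = B (mv (tadd (ref ℓ) x)) := by abel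
    rw [e2, ← dist_eq_norm] at h
    linarith
  have hma : ‖mv (tadd (ref ℓ) x)‖ ≤ 4642 / 1000 := by
    have hl := hBlo (mv (tadd (ref ℓ) x))
    rw [hD, hτ] at hBa
    by_contra hc
    rw [not_le] at hc
    nlinarith [mul_le_mul_of_nonneg_left hc.le hν.le]
  -- (2) centred in-layer part `u` and the tree's LEVEL BOX (`‖mv label‖ ≤ 24/5 ⇒ |u_c| ≤ 18 − |ℓ|`)
  have hcen := tadd_tsub_centre ℓ (tadd (ref ℓ) x)
  have hu0 : thsum (tsub (tadd (ref ℓ) x) (2 * ℓ, 2 * ℓ, 2 * ℓ)) = 0 := by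
    rw [thsum_tsub, thsum_tadd, (hC1 ℓ hℓ1 hℓ2).2.1, thsum_centre]
    have hx0 : thsum x = 0 := hxL.1
    rw [hx0]; ring
  have hR : ‖mv (tadd (2 * ℓ, 2 * ℓ, 2 * ℓ) (tsub (tadd (ref ℓ) x) (2 * ℓ, 2 * ℓ, 2 * ℓ)))‖ ≤ 24 / 5 := by
    rw [hcen]; exact hma.trans (by norm_num)
  obtain ⟨hb1, hb2, hb3⟩ := level_box hu0 hR
  -- (3) establishment of the label and site uniqueness
  obtain ⟨-, -, -, -, hsite⟩ := hC1 ℓ hℓ1 hℓ2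
  obtain ⟨k, M, -, hνlo, hνhi, hE⟩ := hsite (tsub (tadd (ref ℓ) x) (2 * ℓ, 2 * ℓ, 2 * ℓ)) (by rw [hcen, tsub_tadd_self]; exact hxL) hb1 hb2 hb3
  rw [hcen] at hE
  have hDT : dR (nearestDist y i) 31 ≤
      dR (nearestDist y i) 31 + 1 / 10 ^ 4 * (10347 / 10000 * nearestDist y i) + tauR (nearestDist y i) 31 := by
    rw [hD, hτ]; nlinarith [hν]
  have hkm : k = m := hC5 k m (tadd (ref ℓ) x) hνm (hE.2.2.trans hDT) hpos
  subst hkm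
  exact ⟨ℓ, x, M, hℓ1, hℓ2, hxL, hνlo, hνhi, hE⟩

end Datum

/-! ## §2 Record forms: one chart datum on `B(y c, ρ·ν_c)`, base `i` with `12·ν_i + dist (y i) (y c) ≤ ρ·ν_c`, frame `(ν_i • A i) ∘ flipIso s` -/

section Record

variable {ρ : ℝ} {y : Fin N → E3} {c i : Fin N} {A : Fin N → (E3 →ₗ[ℝ] E3)} {Qf : Fin N → (E3 →ₗᵢ[ℝ] E3)} {P : Fin N → Finset E3} {f : Fin N → E3 → E3}
  {s : T3} {hs : IsSign s} {ref : ℤ → T3} {Cz : ℤ → List T3} {e : ℤ → ℤ}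

/-- ★★ **FIVE CUBIC LEVELS AT A BASE WITH `¬HNear 2`, record form.**  The re-based layer-rigidity datum at `i` produced by
`…RunCutRebase.layer_rigidity_rebase_charts` (clauses 1–5, in the record frame) has `Cz ℓ ∈ {fccL, fccNegL}` for `|ℓ| ≤ 2` whenever no site within `2ν_i` of `y i` is
`HFramed (3/50) (1/450)`. [this file] -/
theorem levels_fcc_of_rebase (hy : Function.Injective y)
    (hP : ∀ j, dist (y j) (y c) ≤ ρ * nearestDist y c → (P j = fccTwoShellPattern ∨ P j = hcpTwoShellPattern))
    (hA : ∀ j, dist (y j) (y c) ≤ ρ * nearestDist y c → ∀ v ∈ P j, ‖A j v - Qf j v‖ ≤ 1 / 1000)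
    (hf : ∀ j, dist (y j) (y c) ≤ ρ * nearestDist y c → ∀ v ∈ P j,
      f j v ∈ Set.range y ∧ dist (f j v) (y j + nearestDist y j • A j v) ≤ 1 / 10 ^ 4 * nearestDist y j)
    (hinj : ∀ j, dist (y j) (y c) ≤ ρ * nearestDist y c → Set.InjOn (f j) ↑(P j))
    (hex : ∀ j, dist (y j) (y c) ≤ ρ * nearestDist y c → ∀ m, m ≠ j → dist (y m) (y j) ≤ (3 / 2 + 1 / 450) * nearestDist y j →
      ∃ v ∈ P j, f j v = y m)
    (hi : 12 * nearestDist y i + dist (y i) (y c) ≤ ρ * nearestDist y c)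
    (hC1 : ∀ ℓ : ℤ, -5 ≤ ℓ → ℓ ≤ 5 → Cz ℓ ∈ [fccL, fccNegL, hcpL, hcpAltL] ∧ thsum (ref ℓ) = 6 * ℓ ∧ (ref ℓ).2.1 = (ref ℓ).1 ∧
        (3 : ℤ) ∣ ((ref ℓ).2.1 - (ref ℓ).2.2) ∧
        ∀ u : T3, InLayer (tsub (tadd (2 * ℓ, 2 * ℓ, 2 * ℓ) u) (ref ℓ)) → |u.1| ≤ 18 - |ℓ| → |u.2.1| ≤ 18 - |ℓ| → |u.2.2| ≤ 18 - |ℓ| →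
          ∃ k : Fin N, ∃ M : E3 →ₗᵢ[ℝ] E3,
            dist (y k) (y i) ≤ 12 * nearestDist y i ∧ 9026 / 10000 * nearestDist y i ≤ nearestDist y k ∧
            nearestDist y k ≤ 10347 / 10000 * nearestDist y i ∧
            Estab y A P ((nearestDist y i • A i) ∘ₗ (flipIso s hs).toLinearMap) i k M (Cz ℓ) (tadd (2 * ℓ, 2 * ℓ, 2 * ℓ) u)
              (tauR (nearestDist y i) 31) (dR (nearestDist y i) 31))
    (hC2 : ∀ ℓ : ℤ, -5 ≤ ℓ → ℓ ≤ 4 → (e ℓ = 1 ∨ e ℓ = -1) ∧ ref (ℓ + 1) = tadd (ref ℓ) (capv 1 (e ℓ) (1, 1, -2)) ∧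
        (∀ δ ∈ dL, capv 1 (e ℓ) δ ∈ Cz ℓ) ∧ (∀ δ ∈ dL, capv (-1) (-(e ℓ)) δ ∈ Cz (ℓ + 1)))
    (hC3 : ∃ x₀ : T3, InLayer x₀ ∧ tadd (ref 0) x₀ = (0, 0, 0))
    (hC4 : ∀ m, dist (y m) (y i) ≤ 106 / 25 * nearestDist y i → ∃ (ℓ : ℤ) (x : T3), -5 ≤ ℓ ∧ ℓ ≤ 5 ∧ InLayer x ∧
        ‖y m - y i - ((nearestDist y i • A i) ∘ₗ (flipIso s hs).toLinearMap) (mv (tadd (ref ℓ) x))‖ ≤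
          dR (nearestDist y i) 31 + 1 / 10 ^ 4 * (10347 / 10000 * nearestDist y i) + tauR (nearestDist y i) 31 ∧
        9967 / 10000 * (9026 / 10000 * nearestDist y i) ≤ nearestDist y m)
    (hC5 : ∀ (m m' : Fin N) (r : T3), 9967 / 10000 * (9026 / 10000 * nearestDist y i) ≤ nearestDist y m' →
        ‖y m - y i - ((nearestDist y i • A i) ∘ₗ (flipIso s hs).toLinearMap) (mv r)‖ ≤
          dR (nearestDist y i) 31 + 1 / 10 ^ 4 * (10347 / 10000 * nearestDist y i) + tauR (nearestDist y i) 31 →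
        ‖y m' - y i - ((nearestDist y i • A i) ∘ₗ (flipIso s hs).toLinearMap) (mv r)‖ ≤
          dR (nearestDist y i) 31 + 1 / 10 ^ 4 * (10347 / 10000 * nearestDist y i) + tauR (nearestDist y i) 31 → m = m')
    (hn : ¬ HNear 2 (3 / 50) (1 / 450) y i) :
    ∀ ℓ : ℤ, -2 ≤ ℓ → ℓ ≤ 2 → Cz ℓ = fccL ∨ Cz ℓ = fccNegL := by
  have hP' := ball_restrict hi hP
  have hA' := ball_restrict hi hA
  have hf' := ball_restrict hi hf
  have hinj' := ball_restrict hi hinj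
  have hex' := ball_restrict hi hex
  have hi0 : dist (y i) (y i) ≤ 12 * nearestDist y i := by
    rw [dist_self]; exact mul_nonneg (by norm_num) (nearestDist_nonneg y i)
  have hν : 0 < nearestDist y i := nearestDist_pos_of_frame hy (hP' i hi0) (fun v hv => (hf' i hi0 v hv).1) (hinj' i hi0)
  exact levels_fcc_of_not_hNear hν hP' hA' hf' hinj' hex' (lower_flip hs (base_lower (hP' i hi0) (hA' i hi0)))
    (upper_flip (base_upper (hP' i hi0) (hA' i hi0)) hs) hC1 hC2 hC3 hC4 hC5 hn

/-- ★ **(T3), record form**: every site of the reading ball of the re-based datum at `i` is established (class of its own level, layer label, scale window). [this file] -/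
theorem estab_of_read_rebase (hy : Function.Injective y)
    (hP : ∀ j, dist (y j) (y c) ≤ ρ * nearestDist y c → (P j = fccTwoShellPattern ∨ P j = hcpTwoShellPattern))
    (hA : ∀ j, dist (y j) (y c) ≤ ρ * nearestDist y c → ∀ v ∈ P j, ‖A j v - Qf j v‖ ≤ 1 / 1000)
    (hf : ∀ j, dist (y j) (y c) ≤ ρ * nearestDist y c → ∀ v ∈ P j,
      f j v ∈ Set.range y ∧ dist (f j v) (y j + nearestDist y j • A j v) ≤ 1 / 10 ^ 4 * nearestDist y j)
    (hinj : ∀ j, dist (y j) (y c) ≤ ρ * nearestDist y c → Set.InjOn (f j) ↑(P j))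
    (hi : 12 * nearestDist y i + dist (y i) (y c) ≤ ρ * nearestDist y c)
    (hC1 : ∀ ℓ : ℤ, -5 ≤ ℓ → ℓ ≤ 5 → Cz ℓ ∈ [fccL, fccNegL, hcpL, hcpAltL] ∧ thsum (ref ℓ) = 6 * ℓ ∧ (ref ℓ).2.1 = (ref ℓ).1 ∧
        (3 : ℤ) ∣ ((ref ℓ).2.1 - (ref ℓ).2.2) ∧
        ∀ u : T3, InLayer (tsub (tadd (2 * ℓ, 2 * ℓ, 2 * ℓ) u) (ref ℓ)) → |u.1| ≤ 18 - |ℓ| → |u.2.1| ≤ 18 - |ℓ| → |u.2.2| ≤ 18 - |ℓ| →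
          ∃ k : Fin N, ∃ M : E3 →ₗᵢ[ℝ] E3,
            dist (y k) (y i) ≤ 12 * nearestDist y i ∧ 9026 / 10000 * nearestDist y i ≤ nearestDist y k ∧
            nearestDist y k ≤ 10347 / 10000 * nearestDist y i ∧
            Estab y A P ((nearestDist y i • A i) ∘ₗ (flipIso s hs).toLinearMap) i k M (Cz ℓ) (tadd (2 * ℓ, 2 * ℓ, 2 * ℓ) u)
              (tauR (nearestDist y i) 31) (dR (nearestDist y i) 31))
    (hC4 : ∀ m, dist (y m) (y i) ≤ 106 / 25 * nearestDist y i → ∃ (ℓ : ℤ) (x : T3), -5 ≤ ℓ ∧ ℓ ≤ 5 ∧ InLayer x ∧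
        ‖y m - y i - ((nearestDist y i • A i) ∘ₗ (flipIso s hs).toLinearMap) (mv (tadd (ref ℓ) x))‖ ≤
          dR (nearestDist y i) 31 + 1 / 10 ^ 4 * (10347 / 10000 * nearestDist y i) + tauR (nearestDist y i) 31 ∧
        9967 / 10000 * (9026 / 10000 * nearestDist y i) ≤ nearestDist y m)
    (hC5 : ∀ (m m' : Fin N) (r : T3), 9967 / 10000 * (9026 / 10000 * nearestDist y i) ≤ nearestDist y m' →
        ‖y m - y i - ((nearestDist y i • A i) ∘ₗ (flipIso s hs).toLinearMap) (mv r)‖ ≤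
          dR (nearestDist y i) 31 + 1 / 10 ^ 4 * (10347 / 10000 * nearestDist y i) + tauR (nearestDist y i) 31 →
        ‖y m' - y i - ((nearestDist y i • A i) ∘ₗ (flipIso s hs).toLinearMap) (mv r)‖ ≤
          dR (nearestDist y i) 31 + 1 / 10 ^ 4 * (10347 / 10000 * nearestDist y i) + tauR (nearestDist y i) 31 → m = m')
    {m : Fin N} (hdm : dist (y m) (y i) ≤ 106 / 25 * nearestDist y i) :
    ∃ (ℓ : ℤ) (x : T3) (M : E3 →ₗᵢ[ℝ] E3), -5 ≤ ℓ ∧ ℓ ≤ 5 ∧ InLayer x ∧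
      9026 / 10000 * nearestDist y i ≤ nearestDist y m ∧ nearestDist y m ≤ 10347 / 10000 * nearestDist y i ∧
      Estab y A P ((nearestDist y i • A i) ∘ₗ (flipIso s hs).toLinearMap) i m M (Cz ℓ) (tadd (ref ℓ) x)
        (tauR (nearestDist y i) 31) (dR (nearestDist y i) 31) := by
  have hP' := ball_restrict hi hP
  have hA' := ball_restrict hi hA
  have hf' := ball_restrict hi hf
  have hinj' := ball_restrict hi hinj
  have hi0 : dist (y i) (y i) ≤ 12 * nearestDist y i := by
    rw [dist_self]; exact mul_nonneg (by norm_num) (nearestDist_nonneg y i)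
  have hν : 0 < nearestDist y i := nearestDist_pos_of_frame hy (hP' i hi0) (fun v hv => (hf' i hi0 v hv).1) (hinj' i hi0)
  exact estab_of_read hν (lower_flip hs (base_lower (hP' i hi0) (hA' i hi0))) hC1 hC4 hC5 hdm

end Record

end Summit.AtomisticToContinuum.Crystallization.Theorems.OverbindingBudgetAffineRunCutRead
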